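import Summits.ABC.IUTFork.Cor312TeamBCapstone
import Summits.ABC.IUTFork.Cor312TeamAGapWitnessB
import Mathlib.Topology.Instances.ZMod
import Mathlib.MeasureTheory.MeasurableSpace.Instances
import HarnessLib

/-!
# TEAM B capstone witness, part A: an honest-Haar instantiation satisfying the typed Theorem 3.11

Record-only file (D-0012) of the abc-iut cell (Cor. 3.12 STRATEGY TEAM B «estimate / log-Kummer»,
HUMAN RULING D-0067 (3), seat abc-iut-c312-11 = B1; first half of the answer to audit note N2 of seat
w5-d155 on p413800, STATUS 2026-08-26T00:31:07Z); TAKES NO SIDE. The TEAM B capstone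
`Cor312Vol.teamB_capstone_of_latticeRealisations` (`Cor312TeamBCapstone`) consumes TWELVE side
conditions of Haar-reading/realisation type over a container family `W` carrying genuine
`IntegralStructure`s; the independence certificates in the tree live at the weaker ROUTE-level premise
set, and no kernel witness showed the capstone's own premise set jointly satisfiable with the negation
of its residual input `QFrobEqualityAt P 0` — w5-d155's note N2. THIS file builds the instantiation;
the companion `Cor312CapstoneWitnessB` discharges the twelve conditions and the negations.

* `Lam4`/`eMap` — an HONEST Haar container: `W = ZMod 4` (discrete; Mathlib's topology, σ-algebra and
  Borel instances), integral structure `Λ = ⊤` with THE normalised Haar measure (`Λ.haar Λ = 1`,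
  `NormalizedHaar.lean`), under which `μ{x} = 1/4` by translation invariance and additivity and
  `μ{0, 2} = 1/2` — genuine measure theory, not an ad-hoc volume function; `eMap` compares each toy
  packet (a nontrivial `ℚ`-line, `Cor312TeamAGapWitness.packetEquiv`) to the container (`0 ↦ 0`, the
  rest to `2`), separating the `q`-pilot image (volume `1/2`) from the Θ-pilot Kummer images
  (volume `1/4`).
* `haarData`/`haarSituation`/`haarColumn`/`haarFull` — the mono-analytic data (a)(b)(c) DEFINED
  through the container (`HaarAdm`/`haarVol` = positive-finite-volume / normalised log-volume of the
  `eMap`-image, so the capstone's container readings hold by `rfl`/`Iff.rfl`), with exact Kummer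
  columns and the Team A link objects.
* `haarFull_statement` — the typed **Theorem 3.11 (i) ∧ (ii) ∧ (iii) holds in full** at the witness.

HONEST SCOPE: interface-level, toy carriers (`l⋆ = 2`, one place, `ℚ`-line packets, `ZMod 4`
container). Sources: [IUTchIII] pp. 153–158, 173–175; [AbsTopIII] Prop. 5.7 (i) (the Haar
log-volume). [claim: Mochizuki2012, status: disputed]
[cite: MochizukiAbsTopIII2015, Prop. 5.7 (i) pp. 137–138] [cite: ScholzeStix2018, §2.2 pp. 9–10]
Deliberately NOT here: the setting, the capstone instantiation and the failure of the residual input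
(part B), any real-setting discharge, any judgement on Cor. 3.12 or its gap rows.
-/

noncomputable section

namespace Summit.ABC

namespace IUTFork

namespace Cor312Vol

namespace CapstoneWitness

open Thm311 Cor312 Cor312.Checks Cor312Vol.GapWitness Literature.IUT.LogVolume
  Literature.IUT.LogThetaLattice MeasureTheory Set
open scoped ENNReal Pointwise

/-! ## 1. The honest Haar container: `ZMod 4` with its normalised Haar measure -/

/-- The integral structure `Λ = ⊤ ⊆ ZMod 4`: the whole (finite, discrete, hence compact open)
additive group, carrying THE normalised Haar measure `μ_Λ` with `μ_Λ(Λ) = 1` ([AbsTopIII] Prop. 5.7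
(i)(a), `NormalizedHaar.lean`). [cite: MochizukiAbsTopIII2015, Prop. 5.7 (i) p. 137] -/
def Lam4 : IntegralStructure (ZMod 4) := ⟨⊤, (Set.toFinite _).isCompact⟩

/-- The integral structure is the whole group. [folklore] -/
theorem coe_Lam4 : (Lam4 : Set (ZMod 4)) = Set.univ := rfl

/-- Normalisation: `μ(ZMod 4) = 1`. [cite: MochizukiAbsTopIII2015, Prop. 5.7 (i)(a)(3) p. 137] -/
theorem Lam4_haar_univ : Lam4.haar Set.univ = 1 := by
  rw [← coe_Lam4]; exact Lam4.haar_self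

/-- Counting formula: every singleton has volume `1/4` (translation invariance + additivity +
normalisation — the index formula `μ(H) = [Λ : H]⁻¹` at `H = 0`).
[cite: MochizukiAbsTopIII2015, Prop. 5.7 (i)(a) p. 137] -/
theorem Lam4_haar_singleton (x : ZMod 4) : Lam4.haar {x} = 4⁻¹ := by
  have hx : ∀ y : ZMod 4, Lam4.haar {y} = Lam4.haar {0} := by
    intro y
    have h := measure_preimage_add Lam4.haar (-y) ({0} : Set (ZMod 4))
    have hset : ((fun z : ZMod 4 => -y + z) ⁻¹' {0}) = {y} := by
      ext z
      simp [eq_comm]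
    rwa [hset] at h
  have hdisj : Pairwise (Function.onFun Disjoint fun y : ZMod 4 => ({y} : Set (ZMod 4))) :=
    fun _ _ hab => Set.disjoint_singleton.2 hab
  have hsum : Lam4.haar Set.univ = ∑' y : ZMod 4, Lam4.haar {y} := by
    rw [← Set.iUnion_of_singleton (ZMod 4),
      measure_iUnion hdisj fun y => (isOpen_discrete _).measurableSet]
  rw [Lam4_haar_univ, tsum_fintype] at hsum
  simp only [hx] at hsum
  rw [Finset.sum_const, Finset.card_univ, ZMod.card] at hsum
  have hmul : (4 : ℝ≥0∞) * Lam4.haar {0} = 1 := by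
    rw [nsmul_eq_mul] at hsum
    simp only [Nat.cast_ofNat] at hsum
    exact hsum.symm
  rw [hx x, show ((4 : ℝ≥0∞))⁻¹ = 1 / 4 by rw [one_div]]
  exact (ENNReal.eq_div_iff (by norm_num) (by norm_num)).2 hmul

/-- Index formula: the subgroup `{0, 2}` of index `2` has volume `1/2`.
[cite: MochizukiAbsTopIII2015, Prop. 5.7 (i)(a) p. 137] -/
theorem Lam4_haar_pair : Lam4.haar ({0, 2} : Set (ZMod 4)) = 2⁻¹ := by
  have hd : Disjoint ({0} : Set (ZMod 4)) {2} := by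
    rw [Set.disjoint_singleton]
    decide
  rw [show ({0, 2} : Set (ZMod 4)) = {0} ∪ {2} from rfl,
    measure_union hd ((isOpen_discrete _).measurableSet), Lam4_haar_singleton, Lam4_haar_singleton]
  rw [show ((4 : ℝ≥0∞))⁻¹ = 1 / 4 by rw [one_div], show ((2 : ℝ≥0∞))⁻¹ = 1 / 2 by rw [one_div],
    ENNReal.div_add_div_same, show (1 + 1 : ℝ≥0∞) = 2 by norm_num,
    ENNReal.div_eq_div_iff (by norm_num) (by norm_num) (by norm_num) (by norm_num)]
  norm_num

/-- Any nonempty subset of the (discrete, finite) container is a nonempty compact open, hence has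
positive finite volume — the admissibility `M(−)` of the container is "nonempty".
[cite: MochizukiAbsTopIII2015, Prop. 5.7 (i)(a) p. 137] -/
theorem Lam4_haar_pos_lt_top {s : Set (ZMod 4)} (hs : s.Nonempty) :
    0 < Lam4.haar s ∧ Lam4.haar s < ⊤ :=
  ⟨Lam4.haar_pos_of_isOpen (isOpen_discrete s) hs,
    Lam4.haar_lt_top_of_isCompact (Set.toFinite s).isCompact⟩

open scoped Classical in
/-- The (bare) comparison map from a toy packet to the Haar container: `0 ↦ 0`, everything else to
`2` — it separates the `q`-pilot image (everything, image `{0, 2}`, volume `1/2`) from the Θ-pilot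
Kummer images (`{0}`, image `{0}`, volume `1/4`). [folklore] -/
def eMap (j : toyIndex.Label) (vQ : toyIndex.VQ) (x : toyShells.Packet j vQ) : ZMod 4 :=
  if x = 0 then 0 else 2

open scoped Classical in
/-- `eMap` sends a linear-automorphism image to the same value (linear equivalences fix `0` and
nonzero-ness). [folklore] -/
theorem eMap_comp_linearEquiv {j : toyIndex.Label} {vQ : toyIndex.VQ}
    (Φ : toyShells.Packet j vQ ≃ₗ[ℚ] toyShells.Packet j vQ) (x : toyShells.Packet j vQ) :
    eMap j vQ (Φ x) = eMap j vQ x := by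
  unfold eMap
  exact if_congr (LinearEquiv.map_eq_zero_iff Φ) rfl rfl

/-- The `eMap`-image of `{0}` is `{0}`. [folklore] -/
theorem eMap_image_zero (j : toyIndex.Label) (vQ : toyIndex.VQ) :
    eMap j vQ '' ({0} : Set (toyShells.Packet j vQ)) = ({0} : Set (ZMod 4)) := by
  rw [Set.image_singleton]
  unfold eMap
  rw [if_pos rfl]

/-- The `eMap`-image of the whole packet is the index-2 subgroup `{0, 2}` (the packet is a nontrivial
`ℚ`-line, so both values are attained). [folklore] -/
theorem eMap_image_univ (j : toyIndex.Label) (vQ : toyIndex.VQ) :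
    eMap j vQ '' (Set.univ : Set (toyShells.Packet j vQ)) = ({0, 2} : Set (ZMod 4)) := by
  apply Set.Subset.antisymm
  · rintro _ ⟨x, -, rfl⟩
    unfold eMap
    split_ifs
    · exact Set.mem_insert _ _
    · exact Set.mem_insert_of_mem _ rfl
  · haveI := packet_nontrivial j vQ
    obtain ⟨x0, hx0⟩ := exists_ne (0 : toyShells.Packet j vQ)
    rintro z (rfl | rfl)
    · exact ⟨0, Set.mem_univ _, by unfold eMap; rw [if_pos rfl]⟩
    · exact ⟨x0, Set.mem_univ _, by unfold eMap; rw [if_neg hx0]⟩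

/-- A set has a nonempty `eMap`-image iff it is nonempty. [folklore] -/
theorem eMap_image_nonempty_iff (j : toyIndex.Label) (vQ : toyIndex.VQ)
    (A : Set (toyShells.Packet j vQ)) : (eMap j vQ '' A).Nonempty ↔ A.Nonempty :=
  Set.image_nonempty

/-! ## 2. The mono-analytic data DEFINED through the Haar container -/

/-- Admissibility read off the Haar container: positive finite `μ_Λ`-volume of the `eMap`-image —
EXACTLY the right-hand side of the capstone's reading hypothesis `hAdm`, so that hypothesis holds by
`Iff.rfl`. [claim: Mochizuki2012, status: disputed] -/
@[claim "Mochizuki2012" "disputed"]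
def HaarAdm (j : toyIndex.Label) (vQ : toyIndex.VQ) (A : Set (toyShells.Packet j vQ)) : Prop :=
  0 < Lam4.haar (eMap j vQ '' A) ∧ Lam4.haar (eMap j vQ '' A) < ⊤

/-- The mono-analytic log-volume read off the Haar container: the normalised log-volume (weight `1`)
of the `eMap`-image — EXACTLY the right-hand side of the capstone's reading hypothesis `hlogvol`, so
that hypothesis holds by `rfl`. [claim: Mochizuki2012, status: disputed] -/
def haarVol (j : toyIndex.Label) (vQ : toyIndex.VQ) (A : Set (toyShells.Packet j vQ)) : ℝ :=
  Lam4.normalizedLogVolume 1 (eMap j vQ '' A)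

/-- `HaarAdm` is "nonempty" (nonempty compact opens of the finite discrete container). [folklore] -/
theorem haarAdm_iff_nonempty (j : toyIndex.Label) (vQ : toyIndex.VQ)
    (A : Set (toyShells.Packet j vQ)) : HaarAdm j vQ A ↔ A.Nonempty := by
  constructor
  · rintro ⟨hpos, -⟩
    rw [← eMap_image_nonempty_iff j vQ]
    exact nonempty_of_measure_ne_zero hpos.ne'
  · intro hA
    exact Lam4_haar_pos_lt_top ((eMap_image_nonempty_iff j vQ A).2 hA)

/-- `haarVol` is monotone on `HaarAdm`-regions (genuine measure monotonicity through the container).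
[folklore] -/
theorem haarVol_mono {j : toyIndex.Label} {vQ : toyIndex.VQ}
    {A B : Set (toyShells.Packet j vQ)} (hA : HaarAdm j vQ A) (hB : HaarAdm j vQ B) (hAB : A ⊆ B) :
    haarVol j vQ A ≤ haarVol j vQ B :=
  Lam4.normalizedLogVolume_mono 1 hA.1 hB.2 (Set.image_mono hAB)

/-- The Θ-side value: `haarVol {0} = log(1/4)`. [folklore] -/
theorem haarVol_zero (j : toyIndex.Label) (vQ : toyIndex.VQ) :
    haarVol j vQ ({0} : Set (toyShells.Packet j vQ)) = Real.log 4⁻¹ := by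
  unfold haarVol IntegralStructure.normalizedLogVolume IntegralStructure.logVolume
  rw [eMap_image_zero, Lam4_haar_singleton, Nat.cast_one, div_one, ENNReal.toReal_inv]
  norm_num

/-- The `q`-side value: `haarVol univ = log(1/2)`. [folklore] -/
theorem haarVol_univ (j : toyIndex.Label) (vQ : toyIndex.VQ) :
    haarVol j vQ (Set.univ : Set (toyShells.Packet j vQ)) = Real.log 2⁻¹ := by
  unfold haarVol IntegralStructure.normalizedLogVolume IntegralStructure.logVolume
  rw [eMap_image_univ, Lam4_haar_pair, Nat.cast_one, div_one, ENNReal.toReal_inv]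
  norm_num

/-- The separation the witness runs on: `log(1/4) < log(1/2)`. [folklore] -/
theorem log_quarter_lt_log_half : Real.log 4⁻¹ < Real.log 2⁻¹ :=
  Real.log_lt_log (by norm_num) (by norm_num)

/-- The sign the Corollary's positivity clause needs: `log(1/2) < 0`. [folklore] -/
theorem log_half_neg : Real.log 2⁻¹ < 0 :=
  Real.log_neg (by norm_num) (by norm_num)

/-- Data (a)(b)(c) of the witness: integral structures everything, admissibility and log-volume READ
OFF the Haar container (`HaarAdm`, `haarVol`), empty splitting monoids and number fields.
[claim: Mochizuki2012, status: disputed] -/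
def haarData : MRData toyShells where
  shellPk := fun _ _ => Set.univ
  shellSub := fun _ _ => Set.univ
  Adm := HaarAdm
  logvol := haarVol
  Ψ := fun _ _ => ∅
  act := fun _ _ _ => 0
  Mmod := fun _ => ∅

/-- One Frobenioid object per label, of degree `= haarVol(univ)`, region everything — the degree
clause of Thm. 3.11 (i) (c) reads it off the one place. [folklore] -/
def haarDegrees (j : toyIndex.LabelStar) : GlobalDegrees toyShells j where
  ObjMOD := Unit
  Objmod := Unit
  natIso := Equiv.refl Unit
  deg := fun _ => haarVol j.1 () Set.univ
  region := fun _ _ => Set.univ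

/-- The situation of the witness: the same Haar-read data on every vertical line. [folklore] -/
def haarSituation : Situation toyIndex where
  L := toyShells
  D := fun _ => haarData
  G := fun _ j => haarDegrees j

/-- A column whose transported (holomorphic) readings are literally the Haar-read coric data — the
Kummer isomorphisms are "exact", so Thm. 3.11 (ii) (a) holds by `rfl`; unit images everything (inside
`shellPk = univ`, so (Ind3) holds). [folklore] -/
def haarColumn : Column toyShells where
  frobAdm := fun _ => HaarAdm
  frobLogvol := fun _ => haarVol
  frobΨ := fun _ _ _ => ∅
  frobMmod := fun _ _ => ∅
  unitImage := fun _ _ _ _ => Set.univ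
  ballImage := fun _ _ _ => Set.univ
  ObjLGP := Unit
  frobObjLGP := fun _ => Unit
  kumLGP := fun _ => Equiv.refl Unit
  ObjLgp := Unit
  frobObjLgp := fun _ => Unit
  kumLgp := fun _ => Equiv.refl Unit
  thetaPilot := fun _ => ()

/-- The full situation of the witness (link objects as in the Team A gap witness — they are
independent of the volume data). [folklore] -/
def haarFull : FullSituation toyIndex where
  toSituation := haarSituation
  col := fun _ => haarColumn
  link := gapLink

/-! ## 3. The typed Theorem 3.11 holds at the witness -/

/-- (i) holds: empty splitting monoids, the degree clause reads `haarVol(univ)` at the one place, the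
classes coincide (the data is column-independent). [folklore] -/
theorem haar_partI : haarFull.PartI := by
  refine ⟨fun n v hv x hx => absurd hx (Set.notMem_empty x), fun n j J => ⟨?_, ?_, ?_⟩,
    fun n n' => rfl⟩
  · intro vQ
    exact (haarAdm_iff_nonempty _ vQ _).2 ⟨0, Set.mem_univ 0⟩
  · haveI : Finite toyIndex.VQ := inferInstanceAs (Finite Unit)
    exact Set.toFinite _
  · show haarVol j.1 () Set.univ = ∑ᶠ vQ : toyIndex.VQ, haarVol j.1 vQ Set.univ
    rw [finsum_unique]
    exact congrArg (fun v => haarVol j.1 v Set.univ) (Subsingleton.elim _ _)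

/-- (ii) holds, column by column: the transported data are literally the coric data ((a) by `rfl`,
(b)(c) by `rfl`, (Ind3) since `shellPk = univ`). [folklore] -/
theorem haar_partII : haarFull.toLatticeSituation.PartII := by
  intro n
  refine (Column.partII_iff _ _).2 ⟨fun m j vQ A hA => ⟨hA, rfl⟩, fun _ _ _ => rfl, fun _ _ => rfl,
    ⟨fun _ _ _ _ _ => Set.subset_univ _, fun _ _ vQ h => absurd trivial h⟩⟩

/-- (iii) holds: the link objects are the Team A gap witness's, for which the full-poly-iso squares
commute and the stabilizations are free. [folklore] -/
theorem haar_partIII : haarFull.PartIII := by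
  refine ⟨gapLink.partIIIa_holds, gapLink.partIIIb_holds, ?_, ?_,
    haarFull.evalCompatUpToInd_of_multiradialCompat haar_partI.2.2⟩
  · refine gapLink.partIIIc_of_full (fun _ => rfl) fun n m => ?_
    rintro p ⟨a, rfl⟩; rfl
  · intro n m; exact Thm311.PolyIsoCalc.stabilized_full _ _

/-- **The typed Theorem 3.11 (i) ∧ (ii) ∧ (iii) HOLDS at the witness.** [folklore] -/
theorem haarFull_statement : haarFull.Statement := ⟨haar_partI, haar_partII, haar_partIII⟩

end CapstoneWitness

end Cor312Vol

end IUTFork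

end Summit.ABC

end
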